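import Mathlib
import Literature.NumberTheory.EllipticCurves.IwasawaAlgebraProofs
import HarnessLib

/-!
# Saturated quotients of a finitely generated `Λ`-torsion module are `ℤ_p`-finite and
# `ℤ_p`-torsion-free; nested saturated submodules with equal co-rank coincide
# (pure commutative algebra; cell `bsd-potss`, seat `bsd-potss-k8q-c5` g4; serves the stabilisation
# of divisible parts behind the K8-Gss2 node (R2±) `NoFiniteSubmoduleSigned`,
# items stmt-BirchSwinnertonDyer-19117 / 19222 / 19233, binder 19301)

HONEST FRAMING (cell `bsd-potss`, run/shared/lean/pub/bsd-potss/; FULL-BSD rank ≤ 1 programme,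
tranche 1b): THEOREMS ONLY — module theory over `Λ = ℤ_p⟦T⟧` and `ℤ_p` (Mathlib rank–nullity over a
domain, the tree's Weierstrass-division finiteness lemma `finite_of_lengthAt_eq_zero`). NO
elliptic-curve input, NO named fact, NO definition; nothing booked; BSD is not proved by any of this.

CONTENT (the algebra of "since `X` is `Λ`-torsion, the `ℤ_p`-coranks are bounded" in
Hachimori–Matsuno, Proc. AMS 128 (2000) p. 2540 = Kitajima–Otsuki 2018 Prop. 4.4): a finitely
generated `Λ`-torsion module `X` is killed by some `p^k·g` with `g ∉ (p)`
(`exists_notMem_augIdealP_forall_pow_nsmul_smul_eq_zero`); if such a `g` multiplies `X` into a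
`Λ`-submodule `N` then `X/N` is finitely generated over `ℤ_p` (`module_finite_padicInt_quotient`); a
`p`-saturated `N` has `ℤ_p`-torsion-free quotient (`quotient_eq_zero_of_smul_eq_zero`); nested
saturated submodules with equal `ℤ_p`-co-rank are equal (`eq_of_le_of_finrank_quotient_eq`); co-ranks
are monotone (`finrank_quotient_le_of_le`); a monotone bounded sequence of naturals is eventually
constant (`exists_forall_le_eq_of_monotone_of_bounded`).

References: [HachimoriMatsuno2000] Proc. Amer. Math. Soc. 128 (2000) 2539–2541, proof of the Theorem
(p. 2540); [KitajimaOtsuki2018] Tokyo J. Math. 41 (2018), Prop. 4.4 (arXiv:1607.03612 p. 18);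
[Washington1997] L. C. Washington, Introduction to Cyclotomic Fields, §13.2.
-/

set_option autoImplicit false

noncomputable section

open scoped Classical

open Literature.NumberTheory.EllipticCurves Literature.NumberTheory.EllipticCurves.IwasawaAlgebra

namespace Summit.BirchSwinnertonDyer.Rank1Residual.Iwasawa

variable (p : ℕ) [Fact p.Prime]

/-! ## §1 Finitely generated `Λ`-torsion modules: a `p`-free annihilator, `ℤ_p`-finiteness and
`ℤ_p`-torsion-freeness of saturated quotients, rank–nullity -/

section Torsion

variable {X : Type*} [AddCommGroup X] [Module (IwasawaAlgebra p) X]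

/-- **A finitely generated `Λ`-torsion module is killed by `p^k · g` with `p ∤ g`**: a non-zero
annihilator exists (`Λ` is a domain) and factors as `(p)^k · g`, `g ∉ (p)` (`Λ` is Noetherian, so
powers of the non-unit `p` eventually stop dividing). [cite: Washington1997, §13.2] -/
theorem exists_notMem_augIdealP_forall_pow_nsmul_smul_eq_zero [Module.Finite (IwasawaAlgebra p) X]
    (htor : Module.IsTorsion (IwasawaAlgebra p) X) :
    ∃ g : IwasawaAlgebra p, g ∉ augIdealP p ∧ ∃ k : ℕ, ∀ x : X, p ^ k • (g • x) = 0 := by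
  obtain ⟨s, hs, hs0⟩ := Submodule.annihilator_top_inter_nonZeroDivisors htor
  have hs_ne : s ≠ 0 := nonZeroDivisors.ne_zero hs0
  have hpu : ¬IsUnit (PowerSeries.C (p : ℤ_[p]) : IwasawaAlgebra p) := by
    intro hu
    have := PowerSeries.isUnit_constantCoeff _ hu
    rw [PowerSeries.constantCoeff_C] at this
    exact (PadicInt.irreducible_p (p := p)).not_isUnit this
  obtain ⟨k, g, hg, hsg⟩ := WfDvdMonoid.max_power_factor' hs_ne hpu
  refine ⟨g, ?_, k, fun x ↦ ?_⟩
  · intro hmem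
    exact hg (Ideal.mem_span_singleton.mp hmem)
  · have hsx : s • x = 0 := Submodule.mem_annihilator.mp hs x Submodule.mem_top
    rw [hsg, mul_smul, map_natCast, ← Nat.cast_pow, Nat.cast_smul_eq_nsmul] at hsx
    exact hsx

variable [Module ℤ_[p] X] [IsScalarTower ℤ_[p] (IwasawaAlgebra p) X]

/-- If `g ∉ (p)` multiplies `X` into the `Λ`-submodule `N` (with `X` finitely generated over `Λ`),
then `X/N` is finitely generated over `ℤ_p`: `g` kills `X/N`, so `(X/N)_{(p)} = 0`, and the tree's
Weierstrass-division lemma `finite_of_lengthAt_eq_zero` applies. [cite: Washington1997, §13.2] -/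
theorem module_finite_padicInt_quotient [Module.Finite (IwasawaAlgebra p) X]
    {g : IwasawaAlgebra p} (hg : g ∉ augIdealP p) (N : Submodule (IwasawaAlgebra p) X)
    (hgN : ∀ x : X, g • x ∈ N) : Module.Finite ℤ_[p] (X ⧸ N) := by
  let 𝔭 : PrimeSpectrum (IwasawaAlgebra p) := ⟨augIdealP p, isPrime_augIdealP_holds p⟩
  have hgM : Module.IsTorsionBy (IwasawaAlgebra p) (X ⧸ N) g := by
    intro q
    obtain ⟨x, rfl⟩ := Submodule.mkQ_surjective N q
    rw [Submodule.mkQ_apply, ← Submodule.Quotient.mk_smul, Submodule.Quotient.mk_eq_zero]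
    exact hgN x
  exact finite_of_lengthAt_eq_zero p (X ⧸ N) 𝔭 rfl
    (Literature.NumberTheory.EllipticCurves.Module.lengthAt_eq_zero_of_isTorsionBy hgM 𝔭 hg)

omit [Module (IwasawaAlgebra p) X] [IsScalarTower ℤ_[p] (IwasawaAlgebra p) X] in
/-- In a `ℤ_p`-module, `(p^k : ℤ_p) • x = p^k • x`. [folklore] -/
theorem padicInt_pow_smul_eq_nsmul (k : ℕ) (x : X) : ((p : ℤ_[p]) ^ k) • x = p ^ k • x := by
  rw [← Nat.cast_pow, Nat.cast_smul_eq_nsmul]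

/-- **A `p`-saturated submodule has `ℤ_p`-torsion-free quotient**: if `p • x ∈ N ⟹ x ∈ N`, then
`a • m = 0` with `a ≠ 0` in `ℤ_p` forces `m = 0` in `X/N` (`a = u·p^v`, `u` a unit).
[folklore] -/
theorem quotient_eq_zero_of_smul_eq_zero (N : Submodule (IwasawaAlgebra p) X)
    (hsat : ∀ x : X, p • x ∈ N → x ∈ N) {a : ℤ_[p]} (ha : a ≠ 0) {m : X ⧸ N}
    (ham : a • m = 0) : m = 0 := by
  have hsatk : ∀ (k : ℕ) (x : X), p ^ k • x ∈ N → x ∈ N := by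
    intro k
    induction k with
    | zero => intro x hx; simpa using hx
    | succ k ih =>
      intro x hx
      refine hsat x (ih (p • x) ?_)
      rw [← mul_nsmul, ← pow_succ']
      exact hx
  obtain ⟨x, rfl⟩ := Submodule.mkQ_surjective N m
  rw [Submodule.mkQ_apply, Submodule.Quotient.mk_eq_zero]
  rw [Submodule.mkQ_apply, ← Submodule.Quotient.mk_smul, Submodule.Quotient.mk_eq_zero] at ham
  have hu := PadicInt.unitCoeff_spec ha
  -- `p^v • x = u⁻¹ • (a • x) ∈ N`
  have hpx : ((p : ℤ_[p]) ^ a.valuation) • x ∈ N := by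
    have h1 : ((PadicInt.unitCoeff ha : ℤ_[p]ˣ) : ℤ_[p]) • (((p : ℤ_[p]) ^ a.valuation) • x) ∈
        N.restrictScalars ℤ_[p] := by
      rw [← mul_smul, ← hu]
      exact ham
    have h2 := (N.restrictScalars ℤ_[p]).smul_mem
      (((PadicInt.unitCoeff ha)⁻¹ : ℤ_[p]ˣ) : ℤ_[p]) h1
    rwa [← mul_smul, Units.inv_mul, one_smul] at h2
  rw [padicInt_pow_smul_eq_nsmul] at hpx
  exact hsatk _ x hpx

/-- **Rank–nullity for nested saturated submodules**: if `N' ≤ N` are `Λ`-submodules, `N'`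
`p`-saturated, `X/N'` finitely generated over `ℤ_p`, and `rank_{ℤ_p} X/N = rank_{ℤ_p} X/N'`, then
`N = N'` (the kernel `N/N'` of `X/N' ↠ X/N` is a rank-zero submodule of a torsion-free module).
[folklore] -/
theorem eq_of_le_of_finrank_quotient_eq {N N' : Submodule (IwasawaAlgebra p) X} (hle : N' ≤ N)
    (hsat : ∀ x : X, p • x ∈ N' → x ∈ N') [Module.Finite ℤ_[p] (X ⧸ N')]
    (hrank : Module.finrank ℤ_[p] (X ⧸ N) = Module.finrank ℤ_[p] (X ⧸ N')) : N = N' := by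
  refine le_antisymm ?_ hle
  -- the kernel `K = N/N'` of `X/N' → X/N`
  set K : Submodule (IwasawaAlgebra p) (X ⧸ N') := N.map N'.mkQ with hK
  have e : ((X ⧸ N') ⧸ K.restrictScalars ℤ_[p]) ≃ₗ[ℤ_[p]] X ⧸ N :=
    (Submodule.Quotient.restrictScalarsEquiv ℤ_[p] K).trans
      ((Submodule.quotientQuotientEquivQuotient N' N hle).restrictScalars ℤ_[p])
  have hrn' := Submodule.finrank_quotient_add_finrank (K.restrictScalars ℤ_[p])
  rw [e.finrank_eq, hrank] at hrn'
  have hrn : Module.finrank ℤ_[p] (K.restrictScalars ℤ_[p]) = 0 := by omega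
  -- `K` has rank zero inside the torsion-free `X/N'`, so `K = 0`
  have hK0 : ∀ m ∈ K, m = 0 := by
    intro m hm
    obtain ⟨a, ha, ham⟩ :=
      (Module.finrank_eq_zero_iff (R := ℤ_[p]) (M := K.restrictScalars ℤ_[p])).mp hrn ⟨m, hm⟩
    have ham' : a • m = 0 := by
      have := congrArg (fun z : K.restrictScalars ℤ_[p] ↦ (z : X ⧸ N')) ham
      simpa using this
    exact quotient_eq_zero_of_smul_eq_zero p N' hsat ha ham'
  intro x hx
  have hxK : N'.mkQ x ∈ K := Submodule.mem_map_of_mem hx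
  have := hK0 _ hxK
  rwa [Submodule.mkQ_apply, Submodule.Quotient.mk_eq_zero] at this

/-- **Bounded rank**: if `G ≤ N` with `X/G` finitely generated over `ℤ_p`, then
`rank_{ℤ_p} X/N ≤ rank_{ℤ_p} X/G`. [folklore] -/
theorem finrank_quotient_le_of_le {G N : Submodule (IwasawaAlgebra p) X} (hle : G ≤ N)
    [Module.Finite ℤ_[p] (X ⧸ G)] :
    Module.finrank ℤ_[p] (X ⧸ N) ≤ Module.finrank ℤ_[p] (X ⧸ G) := by
  have e : ((X ⧸ G) ⧸ (N.map G.mkQ).restrictScalars ℤ_[p]) ≃ₗ[ℤ_[p]] X ⧸ N :=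
    (Submodule.Quotient.restrictScalarsEquiv ℤ_[p] (N.map G.mkQ)).trans
      ((Submodule.quotientQuotientEquivQuotient G N hle).restrictScalars ℤ_[p])
  rw [← e.finrank_eq]
  exact Submodule.finrank_quotient_le _

end Torsion

/-! ## §2 A monotone bounded sequence of naturals is eventually constant -/

omit [Fact p.Prime] in
/-- A monotone sequence of naturals bounded above is eventually constant. [folklore] -/
theorem exists_forall_le_eq_of_monotone_of_bounded {d : ℕ → ℕ} (hd : Monotone d) {B : ℕ}
    (hB : ∀ n, d n ≤ B) : ∃ m, ∀ n, m ≤ n → d n = d m := by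
  -- the supremum of the (finite) range is attained
  have hne : (Set.range d).Nonempty := ⟨d 0, 0, rfl⟩
  have hbdd : BddAbove (Set.range d) := ⟨B, by rintro _ ⟨n, rfl⟩; exact hB n⟩
  obtain ⟨m, hm⟩ : ∃ m, d m = sSup (Set.range d) := by
    have := Nat.sSup_mem hne hbdd
    obtain ⟨m, hm⟩ := this
    exact ⟨m, hm⟩
  refine ⟨m, fun n hn ↦ le_antisymm ?_ (hd hn)⟩
  rw [hm]
  exact le_csSup hbdd ⟨n, rfl⟩

end Summit.BirchSwinnertonDyer.Rank1Residual.Iwasawa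

end
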